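import Summits.BirchSwinnertonDyer.BirchSwinnertonDyer.Theorems.SignedBaseChangeAnticyclotomicEisensteinDivisibilityAdmdefKolyvaginVertex
import Summits.BirchSwinnertonDyer.BirchSwinnertonDyer.Theorems.SignedBaseChangeAnticyclotomicEisensteinDivisibilityAdmdefToricOrdinary
import Summits.BirchSwinnertonDyer.BirchSwinnertonDyer.Theorems.SignedBaseChangeAnticyclotomicEisensteinDivisibilityAdmdefOrdLineNonzero
import Summits.BirchSwinnertonDyer.BirchSwinnertonDyer.Theorems.SignedBaseChangeAnticyclotomicEisensteinDivisibilityAdmdefBipartitePropagation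
import Literature.NumberTheory.EllipticCurves.CasselsTateSelmerKolyvaginValue
import HarnessLib

/-!
# Line `admdef` (crux `AnticyclotomicEisensteinDivisibility`, stmt-BirchSwinnertonDyer-20727), rigidity road: HOWARD'S TWO EDGE LEMMAS for CHKLL25's
# signed bipartite system at the bottom layer mod 𝔪 — across an edge `m — mq` whose DEFINITE end is a zero vertex the two laws read as equivalences
# «non-zero class at the indefinite end ⟺ unit `λ` at the definite end» (Howard 2006, Cor. 2.3.5 with Lemma 2.3.3, both orientations)

LEAD seat bsd-line-sbc-p1 (gen 32), `--supports stmt-BirchSwinnertonDyer-20727` (helper; OFF the v24 composition path).  LEAD g25's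
`…AdmdefBipartitePropagation` read the two laws of `B` as equivalences «`λ` unit ⟺ `κ` VISIBLE at `q`» (local statements); LEAD g31's
`…AdmdefKolyvaginVertex` / `…AdmdefHowardVanishing` gave one global direction at every vertex.  THIS FILE gives the two GLOBAL EDGE LEMMAS of Howard's
rigidity induction (the shape consumed by the core-graph propagation, sequel `…AdmdefHowardRigidity`):

* §1 `mem_torsionLocalKer_of_resOfLe_zpowers_eq_zero` — the local step: a class `X ∈ H¹(K, E[p])` KUMMER at a good `v ∤ p` whose bottom-layer restriction
  vanishes on `⟨φ⟩` for ONE arithmetic Frobenius `φ` at ONE prime `𝔓 ∣ v` is LOCALLY TRIVIAL at `v` (Gross's criterion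
  `LocalFrob.oneCocycleClass_mem_torsionLocalKer_iff_apply_frob` at the reference prime `𝔓_{ι₀,𝔐}`, reached by conjugating `φ` — Frobenii above `v` are
  conjugate); `forall_mem_ordinaryAt_of_mem_torsionLocalKer` — locally trivial ⟹ `ordinaryAt` every `𝔓 ∣ v` (g31's `…_of_localization_eq_zero` through
  the tree's `mem_torsionLocalKer_iff_res_eq_zero`).
* §2 ★ `isUnit_lam_mul_iff_kappa_ne_zero` — EDGE UP `m — mq` (`m ∈ 𝒩_1^ind`, `q ∤ m` admissible) with `Sel^ε_{mq}(K_0, E[p]) = 0`: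
  `λ_1(mq)(0) ∈ ℤ_pˣ ⟺ κ_1(m)_0 ≠ 0` (⟸: else `κ_1(m)_0` is invisible at `q`, hence ordinary above `q` (§1), hence a class of `Sel^ε_{mq} = 0`).
* §3 ★ `isUnit_lam_iff_kappa_mul_ne_zero` — EDGE DOWN `n — nq` (`n ∈ 𝒩_1^def`, `q ∤ n`) with `Sel^ε_n(K_0, E[p]) = 0`:
  `λ_1(n)(0) ∈ ℤ_pˣ ⟺ κ_1(nq)_0 ≠ 0` (⟸: else the ordinary coordinate of `κ_1(nq)_0` at `q` vanishes (first law), the class is unramified above `q`,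
  hence a class of `Sel^ε_n = 0`).
Frame for §2–§3: `(N : ℤ) = N_E`, `K` imaginary quadratic, `κ` anticyclotomic — and NOTHING else (no (CTRL), no (RAM): the zero-vertex hypothesis is
taken in CHKLL currency).

HONEST FRAMING: theorems only (0 definitions, 0 named facts, 0 `sorry`; standard axioms); nothing about the crux, the anchors (K1 = item
stmt-BirchSwinnertonDyer-33118) or BSD is asserted; no summit statement is proved.

References: [cite: Howard2006, Lem. 2.2.1, Lem. 2.3.3, Lem. 2.3.4, Cor. 2.3.5, Thm. 3.2.3] [cite: CastellaEtAl2025, Thm. 7.4 (both laws), §7.2 (arXiv:2308.10474v2 p0030)]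
[cite: BertoliniDarmon2005, Thm. 4.1, Thm. 4.2, Lemma 2.6] [cite: GrossLMS1991, Prop. 9.6, §7 (7.1)] [cite: BurungaleCastellaKim2021, arXiv:1908.09512 Lem. 7.3]
-/

-- D-0017: single-problem summit, the namespace repeats the problem name by design.
set_option linter.dupNamespace false
set_option autoImplicit false

noncomputable section

open scoped Classical NumberField Pointwise

namespace Summit.BirchSwinnertonDyer.BirchSwinnertonDyer.Theorems.SignedBaseChangeAcDivAdmdefHowardEdges

open CategoryTheory WeierstrassCurve NumberField IsDedekindDomain Field Module
open Literature.NumberTheory.EllipticCurves Literature.NumberTheory.GaloisRepresentations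
open Literature.NumberTheory.EllipticCurves.CastellaHsuKunduLeeLiu2025
open Literature.NumberTheory.EllipticCurves.BertoliniDarmon2005
open Literature.NumberTheory.EllipticCurves.AcSigned
open Summit.BirchSwinnertonDyer.BirchSwinnertonDyer.Theorems.AdditiveKoly
open Summit.BirchSwinnertonDyer.Rank1Residual.X11b.Three.Koly.Method2
open Summit.BirchSwinnertonDyer.BirchSwinnertonDyer.Theorems.SignedBaseChangeAcDivAdmdefCoreRootOfSeenAnchor
open Summit.BirchSwinnertonDyer.BirchSwinnertonDyer.Theorems.SignedBaseChangeAcDivAdmdefRootZero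
open Summit.BirchSwinnertonDyer.BirchSwinnertonDyer.Theorems.SignedBaseChangeAcDivAdmdefSelmerBookkeeping
open Summit.BirchSwinnertonDyer.BirchSwinnertonDyer.Theorems.SignedBaseChangeAcDivAdmdefLayerZeroDictionary
open Summit.BirchSwinnertonDyer.BirchSwinnertonDyer.Theorems.SignedBaseChangeAcDivAdmdefKolyvaginRoot
open Summit.BirchSwinnertonDyer.BirchSwinnertonDyer.Theorems.SignedBaseChangeAcDivAdmdefKolyvaginVertex
open Summit.BirchSwinnertonDyer.BirchSwinnertonDyer.Theorems.SignedBaseChangeAcDivAdmdefHowardVanishing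
open Summit.BirchSwinnertonDyer.BirchSwinnertonDyer.Theorems.SignedBaseChangeAcDivAdmdefUnrLineNonzero
open Summit.BirchSwinnertonDyer.BirchSwinnertonDyer.Theorems.SignedBaseChangeAcDivAdmdefOrdLineNonzero
open Summit.BirchSwinnertonDyer.BirchSwinnertonDyer.Theorems.SignedBaseChangeAcDivAdmdefBipartitePropagation
open Summit.BirchSwinnertonDyer.BirchSwinnertonDyer.Theorems.SignedBaseChangeAcDivAdmdefToricOrdinary
open scoped ContRepresentation

universe u

/-! ## §1 Invisible at one Frobenius + Kummer ⟹ locally trivial ⟹ ordinary at every prime above `v` -/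

section Local

variable {K : Type} [Field K] [NumberField K] (W : WeierstrassCurve ℚ) [W.IsElliptic] [W.IsGloballyMinimal] {p : ℕ} [Fact p.Prime]
  (κ : ZpExtension K p)

omit [W.IsGloballyMinimal] in
/-- **A Kummer class invisible at ONE Frobenius is locally trivial.**  `v ∤ p` a good place, `X ∈ H¹(K, E[p])` satisfying the Kummer condition at
`K_v` (= unramified at every `𝔓 ∣ v`, Gross (7.1)); if `res_{⟨φ⟩}(T X) = 0` for some prime `𝔓 ∣ v` of `K̄` and some arithmetic Frobenius `φ ∈ D_𝔓`,
then `X ∈ torsionLocalKer (K_v)` (its localisation at `v` VANISHES).  Proof: a cocycle `ψ` of `X` vanishes on the inertia group of the reference prime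
`𝔓₁ = 𝔓_{ι₀,𝔐}` (it fixes `E[p]`); `ψ φ = φ b − b` (the hypothesis); a conjugate `F = τ φ τ⁻¹` is a Frobenius at `𝔓₁` with `ψ F = F b' − b'`
(`…AdmdefToricOrdinary.apply_conj_eq_of_apply_eq`); Gross's criterion at `𝔓₁`. [cite: GrossLMS1991, Prop. 9.6, §7 (7.1)] [cite: Howard2006, Lem. 2.2.1] -/
theorem mem_torsionLocalKer_of_resOfLe_zpowers_eq_zero {v : HeightOneSpectrum (𝓞 K)} (hgood : (W.baseChange K).HasGoodReductionAt v)
    (hpv : ((p : ℕ) : 𝓞 K) ∉ v.asIdeal) (X : Vp W K p)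
    (hX : X ∈ selmerLocalKer (W.baseChange K) (v.adicCompletion K) ((p ^ 1 : ℕ) : ℤ))
    {𝔓 : Ideal (absIntegers (𝓞 K) K)} (h𝔓 : 𝔓 ∈ v.primesAbove) {φ : absoluteGaloisGroup K}
    (hφle : Subgroup.zpowers φ ≤ κ.layerSubgroup 0) (hφF : IsArithFrobAt (𝓞 K) φ 𝔓)
    (hres : resOfLe (geomTorsion (W.baseChange K) ((p : ℤ) ^ 1)) hφle
      (resH1Hom (Literature.NumberTheory.EllipticCurves.subgroupIncl (κ.layerSubgroup 0))
        (AddSubgroup.inclusion (geomTorsion_natCast_pow_one W (K := K) (p := p)).le) (fun _ _ ↦ rfl) X) = 0) :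
    X ∈ (W.baseChange K).torsionLocalKer (v.adicCompletion K) ((p ^ 1 : ℕ) : ℤ) := by
  -- adapted from Theorems/…AdmdefRootZero.lean `exists_admissibleFrob_resOfLe_ne_zero` (Gross's criterion, run backwards)
  have hp : p.Prime := Fact.out
  have hn : ((((p ^ 1 : ℕ) : ℤ)) : 𝓞 K) ∉ v.asIdeal := by rw [Int.cast_natCast, Nat.pow_one]; exact hpv
  obtain ⟨ψ, rfl⟩ := oneCocycleClass_surjective
    (discreteTopRep (absoluteGaloisGroup K) (geomTorsion (W.baseChange K) ((p ^ 1 : ℕ) : ℤ))) X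
  -- the reference prime and the inertia there
  haveI : CharZero (v.adicCompletion K) :=
    charZero_of_injective_algebraMap (algebraMap K (v.adicCompletion K)).injective
  obtain ⟨𝔐, h𝔐⟩ := v.localPrimesAbove_nonempty
  set 𝔓₁ := v.primeBelow (closureEmb (K := K) (v.adicCompletion K)) 𝔐 with h𝔓₁def
  have h𝔓₁ : 𝔓₁ ∈ v.primesAbove := v.primeBelow_mem_primesAbove h𝔐
  haveI : 𝔓₁.IsPrime := h𝔓₁.1
  haveI : 𝔓.IsPrime := h𝔓.1
  have hvbad : v ∉ (W.baseChange K).badPlaces (𝓞 K) := fun h ↦ h hgood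
  have hI : 𝔓₁.inertia (absoluteGaloisGroup K) ≤ torsionFixing (W.baseChange K) ((p ^ 1 : ℕ) : ℤ) :=
    inertia_le_torsionFixing (W.baseChange K) hvbad hn _ h𝔐
  -- `ψ` vanishes on `I_{𝔓₁}` (Kummer = unramified at the good place)
  have hψI : ∀ i ∈ 𝔓₁.inertia (absoluteGaloisGroup K), ψ.1 i = 0 := by
    have hx' : oneCocycleClass _ ψ ∈ unramifiedKer (geomTorsion (W.baseChange K) ((p ^ 1 : ℕ) : ℤ)) 𝔓₁ := by
      rw [← (W.baseChange K).selmerLocalKer_eq_unramifiedKer hgood hn h𝔓₁]; exact hX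
    obtain ⟨a, ha⟩ := (oneCocycleClass_mem_subgroupResKer_iff _ ψ).mp hx'
    intro i hi
    rw [ha ⟨i, hi⟩]
    exact sub_eq_zero.mpr (smul_eq_of_mem_torsionFixing (W.baseChange K) _ (hI hi) a)
  -- `ψ φ = φ b − b`
  rw [resOfLe_resH1Hom_layerZero_eq_zero_iff] at hres
  obtain ⟨b, hb⟩ := hres
  have hbφ : ψ.1 φ = φ • b - b := hb ⟨φ, Subgroup.mem_zpowers φ⟩
  -- a conjugate of `φ` is a Frobenius at `𝔓₁`, with a coboundary value too
  obtain ⟨τ, -, hF⟩ := HeightOneSpectrum.exists_isArithFrobAt_conj_of_mem_primesAbove_holds h𝔓 h𝔓₁ hφF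
  have hbF := apply_conj_eq_of_apply_eq W ψ (τ := τ) hbφ
  exact (LocalFrob.oneCocycleClass_mem_torsionLocalKer_iff_apply_frob (W.baseChange K) (n := p ^ 1)
    (pow_pos hp.pos 1).ne' h𝔐 hF hI ψ hψI).mpr ⟨_, hbF⟩

omit [W.IsGloballyMinimal] in
/-- **Locally trivial at `v` ⟹ ORDINARY at every prime above `v`** (g31's `forall_mem_ordinaryAt_of_localization_eq_zero` in the `torsionLocalKer`
currency of the AKR level spaces, through the tree's `mem_torsionLocalKer_iff_res_eq_zero`). [cite: Howard2006, §2.2, Lem. 2.2.1] -/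
theorem forall_mem_ordinaryAt_of_mem_torsionLocalKer {v : HeightOneSpectrum (𝓞 K)} (X : Vp W K p)
    (hX : X ∈ (W.baseChange K).torsionLocalKer (v.adicCompletion K) ((p ^ 1 : ℕ) : ℤ)) :
    ∀ 𝔓 ∈ v.primesAbove,
      resH1Hom (Literature.NumberTheory.EllipticCurves.subgroupIncl (κ.layerSubgroup 0))
          (AddSubgroup.inclusion (geomTorsion_natCast_pow_one W (K := K) (p := p)).le) (fun _ _ ↦ rfl) X ∈
        ordinaryAt (W.baseChange K) ((p : ℤ) ^ 1) (κ.layerSubgroup 0) 𝔓 := by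
  have hp : p.Prime := Fact.out
  haveI : CharZero (v.adicCompletion K) :=
    charZero_of_injective_algebraMap (algebraMap K (v.adicCompletion K)).injective
  haveI : (W.baseChange K).IsElliptic := by unfold WeierstrassCurve.baseChange; infer_instance
  have h0 := (Literature.NumberTheory.EllipticCurves.mem_torsionLocalKer_iff_res_eq_zero (W.baseChange K) (v.adicCompletion K)
    (k := p ^ 1) (pow_ne_zero 1 hp.ne_zero) X).mp hX
  exact forall_mem_ordinaryAt_of_localization_eq_zero W κ X h0

end Local

/-! ## §2 EDGE UP: `m — mq` with `Sel^ε_{mq}(K_0, E[p]) = 0` -/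

section Edges

variable {K : Type} [Field K] [NumberField K] {W : WeierstrassCurve ℚ} [W.IsElliptic] [W.IsGloballyMinimal] {p : ℕ} [Fact p.Prime]
  {κ : ZpExtension K p} {γ : absoluteGaloisGroup K} {N : ℕ} {ε : ℤˣ} {B : SignedBipartiteSystem W K p κ}

omit [W.IsElliptic] [Fact p.Prime] in
/-- The place `(q)` of `K` over an admissible (inert) `q`. [cite: BertoliniDarmon2005, p. 18] -/
theorem exists_place_of_isAdmissiblePrime {q : ℕ} (hq : IsAdmissiblePrime N K (fun ℓ ↦ W.frobeniusTrace ℓ) p 1 q) :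
    ∃ v : HeightOneSpectrum (𝓞 K), ((q : ℕ) : 𝓞 K) ∈ v.asIdeal := by
  have hbot : Ideal.span {((q : ℕ) : 𝓞 K)} ≠ ⊥ := by
    rw [Ne, Ideal.span_singleton_eq_bot]; exact_mod_cast hq.prime.ne_zero
  exact ⟨⟨Ideal.span {((q : ℕ) : 𝓞 K)}, hq.2.2.1, hbot⟩, Ideal.mem_span_singleton_self _⟩

/-- ★ **EDGE UP (Howard Cor. 2.3.5 at an edge `m — mq` whose definite end is a ZERO vertex).**  Frame: `(N : ℤ) = N_E`, `K` imaginary quadratic,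
`κ` anticyclotomic; `B` a signed bipartite system of sign `ε` (CHKLL25 Thm. 7.4); `m ∈ 𝒩_1^ind`, `q` a `1`-admissible prime with `q ∤ m`, and
`Sel^ε_{mq}(K_0, E[p]) = 0`.  THEN `λ_1(mq)(0) ∈ ℤ_pˣ ⟺ κ_1(m)_0 ≠ 0`.  ⟹ is g25/g28's descent (second law, witness-free).  ⟸: if `λ_1(mq)(0)` is not a
unit, the second law as an iff at `𝔓₀` (`isUnit_lam_mul_iff_res_kappa_ne_zero_adicCompletionPrime`) makes `κ_1(m)_0` invisible at a Frobenius of `𝔓₀`;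
its lift `X` is Kummer at `v ∋ q` (`κ_1(m)_0` is unramified there, `q ∤ m`), hence locally trivial at `v` (§1), hence `κ_1(m)_0` is ordinary at every
`𝔓 ∣ v` (§1) and lies in `Sel^ε_{mq}(K_0, E[p]) = 0` (transfer up) — contradiction.
[cite: Howard2006, Lem. 2.3.3, Cor. 2.3.5, Thm. 3.2.3] [cite: CastellaEtAl2025, Thm. 7.4 second law (arXiv:2308.10474v2 p0030 L50–L52)] [cite: BertoliniDarmon2005, Thm. 4.2] -/
theorem isUnit_lam_mul_iff_kappa_ne_zero (hB : IsSignedBipartiteSystem W K p κ γ N ε B)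
    (hN : (N : ℤ) = W.conductorNorm ℤ) (hK : IsImaginaryQuadratic K) (hκ : κ.IsAnticyclotomic) {m q : ℕ}
    (hm : m ∈ indefProducts N K (fun ℓ ↦ W.frobeniusTrace ℓ) p 1)
    (hq : IsAdmissiblePrime N K (fun ℓ ↦ W.frobeniusTrace ℓ) p 1 q) (hqm : ¬ q ∣ m)
    (hzero : ∀ c ∈ signedOrdSelmerTorsion (W.baseChange K) p κ ε (m * q) 0 1, c = 0) :
    IsUnit (PowerSeries.constantCoeff (B.lam 1 (m * q))) ↔ B.kappa 1 m 0 ≠ 0 := by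
  have hp : p.Prime := Fact.out
  have hN' : N = W.conductorNorm ℤ := by exact_mod_cast hN
  have hqE : IsAdmissiblePrime (W.conductorNorm ℤ) K (fun ℓ ↦ W.frobeniusTrace ℓ) p 1 q := hN' ▸ hq
  have hqprime : q.Prime := hq.prime
  have hmq : m * q ∈ defProducts N K (fun ℓ ↦ W.frobeniusTrace ℓ) p 1 := mul_mem_defProducts_of_mem_indefProducts hm hq hqm
  obtain ⟨v, hv⟩ := exists_place_of_isAdmissiblePrime hq
  refine ⟨fun hlam ↦ kappa_layer_zero_ne_zero_of_isUnit_lam_mul_adicCompletionPrime hB hN hK hκ hmq hq hqm hv hlam, fun hκ0 ↦ ?_⟩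
  by_contra hlam
  -- the Frobenius at `𝔓₀` inside `Gal(K̄/K_∞)` and the second law as an iff: `κ_1(m)_0` is invisible at `φ`
  obtain ⟨φ, hφ, hφD, hφF⟩ := exists_isArithFrobAt_mem_kerSubgroup W K hK κ hκ hqE v hv
  have hres : resOfLe (geomTorsion (W.baseChange K) ((p : ℤ) ^ 1))
      ((Subgroup.zpowers_le.mpr hφ).trans (κ.kerSubgroup_le_layerSubgroup 0)) (B.kappa 1 m 0) = 0 := by
    by_contra hne
    exact hlam ((isUnit_lam_mul_iff_res_kappa_ne_zero_adicCompletionPrime hB hN hK.1 hmq hq hqm hv hφ hφD hφF).mpr hne)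
  -- lift and local data at `v`
  obtain ⟨hgood, hpv⟩ := hasGoodReductionAt_of_isAdmissiblePrime W K hqE v hv
  have hpv' : ((p : ℕ) : 𝓞 K) ∉ v.asIdeal := by rw [← Int.cast_natCast]; exact hpv
  have h𝔓₀ := adicCompletionPrime_mem_primesAbove K v
  have hκSel : B.kappa 1 m 0 ∈ signedOrdSelmerTorsion (W.baseChange K) p κ ε m 0 1 :=
    kappa_layer_mem_signedOrdSelmerTorsion hB one_pos hm 0
  obtain ⟨X, hX⟩ := exists_resH1Hom_layerZero_eq W κ (B.kappa 1 m 0)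
  -- no prime of `m` lies under `v` (the only rational prime under `v` is `q ∤ m`)
  have hno : ¬ ∃ ℓ : ℕ, ℓ.Prime ∧ ℓ ∣ m ∧ ((ℓ : ℕ) : 𝓞 K) ∈ v.asIdeal := by
    rintro ⟨ℓ, hℓ, hℓm, hℓv⟩
    have hne : ℓ ≠ q := fun h ↦ hqm (h ▸ hℓm)
    exact not_natCast_mem_of_prime_ne hℓ hqprime hne v hℓv hv
  -- `X` is Kummer at `v`
  have hXk : X ∈ selmerLocalKer (W.baseChange K) (v.adicCompletion K) ((p ^ 1 : ℕ) : ℤ) := by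
    refine (resH1Hom_layerZero_mem_unramifiedAt_iff_mem_selmerLocalKer W κ hgood hpv' h𝔓₀ X).mp ?_
    rw [hX]
    exact ((mem_signedOrdSelmerTorsion_iff _).mp hκSel).2.2 v hpv' hno _ h𝔓₀
  -- hence locally trivial at `v` (§1), hence ordinary above `v`
  have hXt : X ∈ (W.baseChange K).torsionLocalKer (v.adicCompletion K) ((p ^ 1 : ℕ) : ℤ) :=
    mem_torsionLocalKer_of_resOfLe_zpowers_eq_zero W κ hgood hpv' X hXk h𝔓₀
      ((Subgroup.zpowers_le.mpr hφ).trans (κ.kerSubgroup_le_layerSubgroup 0)) hφF (by rw [hX]; exact hres)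
  have hord := forall_mem_ordinaryAt_of_mem_torsionLocalKer W κ X hXt
  -- transfer UP `m ∣ mq`: `κ_1(m)_0 ∈ Sel^ε_{mq}(K_0, E[p]) = 0`
  have hmem : B.kappa 1 m 0 ∈ signedOrdSelmerTorsion (W.baseChange K) p κ ε (m * q) 0 1 := by
    refine mem_signedOrdSelmerTorsion_of_dvd_of_forall_ordinaryAt (dvd_mul_right m q) hκSel ?_
    intro ℓ hℓ hℓmq hℓm w hpw hℓw 𝔓 h𝔓
    have hℓq : ℓ = q := by
      rcases (Nat.Prime.dvd_mul hℓ).mp hℓmq with h | h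
      · exact absurd h hℓm
      · exact (Nat.prime_dvd_prime_iff_eq hℓ hqprime).mp h
    subst hℓq
    have hwv : w = v := placesAbove_eq_of_isPrime_span K hqE.2.2.1 hqprime.ne_zero hv hℓw
    subst hwv
    rw [← hX]
    exact hord 𝔓 h𝔓
  exact hκ0 (hzero _ hmem)

/-! ## §3 EDGE DOWN: `n — nq` with `Sel^ε_n(K_0, E[p]) = 0` -/

/-- ★ **EDGE DOWN (Howard Cor. 2.3.5 at an edge `n — nq` whose definite end `n` is a ZERO vertex).**  Frame as in §2; `n ∈ 𝒩_1^def`, `q` a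
`1`-admissible prime with `q ∤ n`, and `Sel^ε_n(K_0, E[p]) = 0`.  THEN `λ_1(n)(0) ∈ ℤ_pˣ ⟺ κ_1(nq)_0 ≠ 0`.  ⟹ is g25's ascent (first law,
witness-free).  ⟸: if `λ_1(n)(0)` is not a unit, the first law as an iff at `𝔓₀` (`isUnit_lam_iff_ordLoc_kappa_ne_zero_adicCompletionPrime`) kills the
ordinary coordinate `res_{I_{𝔓₀} ∩ Gal(K̄/K_∞)}(κ_1(nq)_0)` (`ordLoc_apply_zero`), so `κ_1(nq)_0` is unramified at `𝔓₀`
(`resOfLe_inertia_ne_zero_of_not_mem_unramifiedAt`), its lift is Kummer at `v ∋ q`, so it is unramified at EVERY `𝔓 ∣ v` and lies in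
`Sel^ε_n(K_0, E[p]) = 0` (transfer down) — contradiction.
[cite: Howard2006, Lem. 2.3.4, Cor. 2.3.5, Thm. 3.2.3] [cite: CastellaEtAl2025, Thm. 7.4 first law (arXiv:2308.10474v2 p0030 L46–L49)] [cite: BertoliniDarmon2005, Thm. 4.1] -/
theorem isUnit_lam_iff_kappa_mul_ne_zero (hB : IsSignedBipartiteSystem W K p κ γ N ε B)
    (hN : (N : ℤ) = W.conductorNorm ℤ) (hK : IsImaginaryQuadratic K) (hκ : κ.IsAnticyclotomic) {n q : ℕ}
    (hn : n ∈ defProducts N K (fun ℓ ↦ W.frobeniusTrace ℓ) p 1)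
    (hq : IsAdmissiblePrime N K (fun ℓ ↦ W.frobeniusTrace ℓ) p 1 q) (hqn : ¬ q ∣ n)
    (hzero : ∀ c ∈ signedOrdSelmerTorsion (W.baseChange K) p κ ε n 0 1, c = 0) :
    IsUnit (PowerSeries.constantCoeff (B.lam 1 n)) ↔ B.kappa 1 (n * q) 0 ≠ 0 := by
  have hp : p.Prime := Fact.out
  have hN' : N = W.conductorNorm ℤ := by exact_mod_cast hN
  have hqE : IsAdmissiblePrime (W.conductorNorm ℤ) K (fun ℓ ↦ W.frobeniusTrace ℓ) p 1 q := hN' ▸ hq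
  have hqprime : q.Prime := hq.prime
  have hnq : n * q ∈ indefProducts N K (fun ℓ ↦ W.frobeniusTrace ℓ) p 1 := mul_mem_indefProducts_of_mem_defProducts hn hq hqn
  obtain ⟨v, hv⟩ := exists_place_of_isAdmissiblePrime hq
  refine ⟨fun hlam ↦ kappa_mul_layer_zero_ne_zero_of_isUnit_lam_adicCompletionPrime hB hN hK hκ hnq hq hqn hv hlam, fun hκ0 ↦ ?_⟩
  by_contra hlam
  -- the first law as an iff: the ordinary coordinate at `𝔓₀` vanishes
  have hord0 : ordLoc (W.baseChange K) p κ γ 1 (adicCompletionPrime K v) (B.kappa 1 (n * q)) 0 0 = 0 := by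
    by_contra hne
    exact hlam ((isUnit_lam_iff_ordLoc_kappa_ne_zero_adicCompletionPrime hB hN hK hκ hnq hq hqn hv).mpr hne)
  rw [ordLoc_apply_zero] at hord0
  obtain ⟨hgood, hpv⟩ := hasGoodReductionAt_of_isAdmissiblePrime W K hqE v hv
  have hpv' : ((p : ℕ) : 𝓞 K) ∉ v.asIdeal := by rw [← Int.cast_natCast]; exact hpv
  have h𝔓₀ := adicCompletionPrime_mem_primesAbove K v
  -- `κ_1(nq)_0` is unramified at `𝔓₀`
  have hunr0 : B.kappa 1 (n * q) 0 ∈ unramifiedAt (W.baseChange K) ((p : ℤ) ^ 1) (κ.layerSubgroup 0) (adicCompletionPrime K v) := by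
    by_contra h
    exact resOfLe_inertia_ne_zero_of_not_mem_unramifiedAt (W := W) (κ := κ) hpv' h𝔓₀ h hord0
  -- lift: Kummer at `v`, so unramified at every prime above `v`
  have hκSel : B.kappa 1 (n * q) 0 ∈ signedOrdSelmerTorsion (W.baseChange K) p κ ε (n * q) 0 1 :=
    kappa_layer_mem_signedOrdSelmerTorsion hB one_pos hnq 0
  obtain ⟨X, hX⟩ := exists_resH1Hom_layerZero_eq W κ (B.kappa 1 (n * q) 0)
  have hXk : X ∈ selmerLocalKer (W.baseChange K) (v.adicCompletion K) ((p ^ 1 : ℕ) : ℤ) := by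
    refine (resH1Hom_layerZero_mem_unramifiedAt_iff_mem_selmerLocalKer W κ hgood hpv' h𝔓₀ X).mp ?_
    rw [hX]; exact hunr0
  have hunr : ∀ 𝔓 ∈ v.primesAbove, B.kappa 1 (n * q) 0 ∈ unramifiedAt (W.baseChange K) ((p : ℤ) ^ 1) (κ.layerSubgroup 0) 𝔓 := by
    intro 𝔓 h𝔓
    rw [← hX]
    exact (resH1Hom_layerZero_mem_unramifiedAt_iff_mem_selmerLocalKer W κ hgood hpv' h𝔓 X).mpr hXk
  -- transfer DOWN `n ∣ nq`: `κ_1(nq)_0 ∈ Sel^ε_n(K_0, E[p]) = 0`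
  have hmem : B.kappa 1 (n * q) 0 ∈ signedOrdSelmerTorsion (W.baseChange K) p κ ε n 0 1 := by
    refine mem_signedOrdSelmerTorsion_of_dvd_of_forall_unramifiedAt (dvd_mul_right n q) hκSel ?_
    intro ℓ hℓ hℓnq hℓn w hpw hℓw 𝔓 h𝔓
    have hℓq : ℓ = q := by
      rcases (Nat.Prime.dvd_mul hℓ).mp hℓnq with h | h
      · exact absurd h hℓn
      · exact (Nat.prime_dvd_prime_iff_eq hℓ hqprime).mp h
    subst hℓq
    have hwv : w = v := placesAbove_eq_of_isPrime_span K hqE.2.2.1 hqprime.ne_zero hv hℓw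
    subst hwv
    exact hunr 𝔓 h𝔓
  exact hκ0 (hzero _ hmem)

end Edges

end Summit.BirchSwinnertonDyer.BirchSwinnertonDyer.Theorems.SignedBaseChangeAcDivAdmdefHowardEdges

end
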